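import Summits.QuantumFields.BalabanUV.Beta.EriceRemainderEnclosureHistoryAutonomyComparisonTowerChainFourLemmas
import Summits.QuantumFields.BalabanUV.Beta.EriceRemainderEnclosureHistoryAutonomyComparisonTowerTen

/-!
# EriceRemainderEnclosureHistoryAutonomyComparisonTowerFreeEndsBudget — (E67b) THE TWO BUDGET LINES FOR TOWERS WITH FREE ENDS: (i) **`budget_line_at`** — the
# ratio-4 budget line `(200∕259)x_k + (120∕109)√(k⁻∕k)·Z_{k⁻} ≤ 1∕2` of (E66a) with the ratio hypothesis `4k⁻ ≤ k` LOCAL to the age (the (E66a) version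
# quantified it over the whole set); (ii) **`crude_line_at`** — at ANY non-minimal age, whatever the ratio `r = k⁻∕k`: `x_k√(1∕2) + √(r∕(1+r))·Z_{k⁻} ≤ 1∕2`
# ((E65h) `budget_crude_of_window` and `√(s∕(s+k)) ≥ √(s∕k⁻)·√(r∕(1+r))` for `s ≤ k⁻`) — the hypothesis of (E67a)'s free steps.  Consumed by (E67c)

Cell `pub-balaban`, β-function sub-cell, BINDER row D4 «RemainderConst leaves for Bałaban's split» (`HOME/BINDER-OWNERS.md`; owner lineage `b2b-balaban-beta-an4`;
this file by co-owner #2 lineage `b2b-balaban-beta-d4-p2`, generation 59), β-FLOW TEAM duty (1), FREEZE (0) honoured (def-free; (E65a)∕(E65h)∕(E65i)∕(E66a)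
lemmas BY NAME).

HONEST FRAMING (page 1, verbatim and binding).  *"Discharging BetaPertH makes Bałaban's UV stability UNCONDITIONAL — a real constructive-QFT result; it is
NOT the continuum limit and NOT the Clay problem."*  THIS FILE DISCHARGES NOTHING OF THE KIND.  Lemmas about finitely many non-negative reals; their use is
through (E65f), whose hypotheses are those of a census, not facts; nothing of Bałaban's is asserted.  Row D4 class UNCHANGED (critical-path width 0; instance
0∕1; D4 DISCHARGE NO DATE).  HONEST DEPENDENCY: continuum YM on T⁴ ⇐ BetaPertH ∧ nine spine estimates (0/9 proved); BetaPertH ⇐ (D1) ∧ (D4) ∧ CAP+tail;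
G-an2-4 gates asym, D1 and NE2/3/4.

WHAT IS PROVED ([folklore]; 0 `def`, 0 sorry).  **`budget_line_at`**, **`crude_line_at`**.
-/
noncomputable section
open Finset

namespace Summit.QuantumFields.BalabanUV.Beta.EriceRemainderEnclosureHistoryAutonomyComparisonTowerFreeEndsBudget

open Summit.QuantumFields.BalabanUV.Beta.EriceRemainderEnclosureHistoryAutonomyComparisonLoadBudgetWindow (mul_sqrt_le_readWindow readWindow_nonneg)
open Summit.QuantumFields.BalabanUV.Beta.EriceRemainderEnclosureHistoryAutonomyComparisonTowerChainSix (readWindow_ge_telescope)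
open Summit.QuantumFields.BalabanUV.Beta.EriceRemainderEnclosureHistoryAutonomyComparisonTowerChainFourLemmas
  (readWindow_one_four_ge readWindow_four_four_ge readWindow_diag_ge)
open Summit.QuantumFields.BalabanUV.Beta.EriceRemainderEnclosureHistoryAutonomyComparisonTowerTen (budget_crude_of_window)

set_option maxHeartbeats 400000 in
/-- **THE BUDGET LINE AT ONE AGE OF RATIO `≥ 4` TO ITS PREDECESSOR** ((E66a) `budget_line_of_tower_four` with the ratio hypothesis LOCAL to the age `k`, so
that towers with exceptional steps elsewhere can use it).  `A` a finite set of ages `≥ 1` with minimum `m₀` and predecessor map `pred`; loads `x ≥ 0` obeying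
the window budget of (E65a) at the scales `j = k ∈ A`; `k ≠ m₀` with `4·pred k ≤ k`.  Then: **`(200∕259)x_k + (120∕109)√(pred k∕k)·Z_{pred k} ≤ 1∕2`**, `Z_q =
Σ_{s∈A, s≤q} x_s√(s∕q)`.  Keep the ages `≤ k` in the budget; the diagonal read is `S_{k,k}∕k ≥ 200∕259` (`readWindow_diag_ge` for `k ≥ 5`, the exact sum at
`k = 4`); the young reads are `S_{s,k}∕k ≥ 2√s∕(√(pred k+k+1) + √(pred k+1))` ((E65i) telescoping) and `(√(pred k+k+1) + √(pred k+1))∕(2√k) ≤ 109∕120` as soon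
as `5(pred k + 1) ≤ 2k` (automatic for `k ≥ 5`, `4·pred k ≤ k`); at `k = 4` (`pred k = m₀ = 1`) the exact `S_{1,4} ≥ 240∕109`. [folklore] -/
theorem budget_line_at {A : Finset ℕ} {x : ℕ → ℝ} {pred : ℕ → ℕ} {m₀ : ℕ}
    (hA1 : ∀ k ∈ A, 1 ≤ k) (hx : ∀ k ∈ A, 0 ≤ x k) (hm₀ : m₀ ∈ A) (hmin : ∀ k ∈ A, m₀ ≤ k)
    (hpred : ∀ k ∈ A, k ≠ m₀ → pred k ∈ A ∧ pred k < k ∧ ∀ k'' ∈ A, k'' < k → k'' ≤ pred k)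
    (hbud : ∀ k ∈ A, ∑ s ∈ A, x s * (if s ≤ k then (∑ l ∈ range k, Real.sqrt ((s : ℝ) / ((s : ℝ) + l + 1))) / k
        else (∑ l ∈ range k, Real.sqrt ((s : ℝ) / ((s : ℝ) + l + 1))) / s) ≤ 1 / 2)
    {k : ℕ} (hk : k ∈ A) (hne : k ≠ m₀) (hfourk : 4 * pred k ≤ k) :
    x k * (200 / 259) + Real.sqrt ((pred k : ℝ) / k) *
        (∑ s ∈ A.filter (fun s => s ≤ pred k), x s * Real.sqrt ((s : ℝ) / pred k)) * (120 / 109) ≤ 1 / 2 := by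
  have hW0 : ∀ k s : ℕ, 0 ≤ (if s ≤ k then (∑ l ∈ range k, Real.sqrt ((s : ℝ) / ((s : ℝ) + l + 1))) / k
      else (∑ l ∈ range k, Real.sqrt ((s : ℝ) / ((s : ℝ) + l + 1))) / s) := fun k s => by
    have := readWindow_nonneg s k; split_ifs <;> positivity
  obtain ⟨hpA, hplt, hpmax⟩ := hpred k hk hne
  have hkr : (0 : ℝ) < k := by exact_mod_cast hA1 k hk
  have hpr : (0 : ℝ) < pred k := by exact_mod_cast hA1 _ hpA
  have hp1 : 1 ≤ pred k := hA1 _ hpA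
  have hfour' : 4 * pred k ≤ k := hfourk
  have hxk := hx k hk
  have hZ0 : 0 ≤ ∑ s ∈ A.filter (fun s => s ≤ pred k), x s * Real.sqrt ((s : ℝ) / pred k) :=
    sum_nonneg fun s hs => mul_nonneg (hx s (mem_filter.mp hs).1) (Real.sqrt_nonneg _)
  -- the budget at scale k with the ages ≤ k kept: diagonal + young reads
  have hset_le : A.filter (fun s => s ≤ k) = insert k (A.filter (fun s => s ≤ pred k)) := by
    ext s; simp only [mem_filter, mem_insert]
    constructor
    · rintro ⟨hs, hsk⟩
      rcases lt_or_eq_of_le hsk with h | h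
      · exact Or.inr ⟨hs, hpmax s hs h⟩
      · exact Or.inl h
    · rintro (rfl | ⟨hs, hsp⟩)
      · exact ⟨hk, le_rfl⟩
      · exact ⟨hs, hsp.trans hplt.le⟩
  have hnot : k ∉ A.filter (fun s => s ≤ pred k) := by
    simp only [mem_filter, not_and, not_le]; exact fun _ => hplt
  have hd : x k * ((∑ l ∈ range k, Real.sqrt ((k : ℝ) / ((k : ℝ) + l + 1))) / k) +
      ∑ s ∈ A.filter (fun s => s ≤ pred k), x s * ((∑ l ∈ range k, Real.sqrt ((s : ℝ) / ((s : ℝ) + l + 1))) / k) ≤ 1 / 2 := by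
    have hb := hbud k hk
    have hdrop' : ∑ s ∈ A.filter (fun s => s ≤ k), x s * ((∑ l ∈ range k, Real.sqrt ((s : ℝ) / ((s : ℝ) + l + 1))) / k) ≤
        ∑ s ∈ A, x s * (if s ≤ k then (∑ l ∈ range k, Real.sqrt ((s : ℝ) / ((s : ℝ) + l + 1))) / k
          else (∑ l ∈ range k, Real.sqrt ((s : ℝ) / ((s : ℝ) + l + 1))) / s) := by
      calc ∑ s ∈ A.filter (fun s => s ≤ k), x s * ((∑ l ∈ range k, Real.sqrt ((s : ℝ) / ((s : ℝ) + l + 1))) / k)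
          = ∑ s ∈ A.filter (fun s => s ≤ k), x s * (if s ≤ k then (∑ l ∈ range k, Real.sqrt ((s : ℝ) / ((s : ℝ) + l + 1))) / k
              else (∑ l ∈ range k, Real.sqrt ((s : ℝ) / ((s : ℝ) + l + 1))) / s) :=
            sum_congr rfl fun s hs => by rw [if_pos (mem_filter.mp hs).2]
        _ ≤ _ := sum_le_sum_of_subset_of_nonneg (filter_subset _ A) fun s hs _ => mul_nonneg (hx s hs) (hW0 k s)
    rw [hset_le, sum_insert hnot] at hdrop'
    exact hdrop'.trans hb
  by_cases hk5 : 5 ≤ k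
  · -- diagonal: telescoped; young: telescoped with the conversion constant 109/120
    have hdg : x k * (200 / 259) ≤ x k * ((∑ l ∈ range k, Real.sqrt ((k : ℝ) / ((k : ℝ) + l + 1))) / k) := by
      refine mul_le_mul_of_nonneg_left ?_ hxk
      rw [le_div_iff₀ hkr]; exact readWindow_diag_ge hk5
    have h52 : 5 * (pred k + 1) ≤ 2 * k := by omega
    have h52r : 5 * ((pred k : ℝ) + 1) ≤ 2 * k := by exact_mod_cast h52
    obtain ⟨ρ, hρ_def⟩ : ∃ ρ : ℝ, ρ = 2 * Real.sqrt (pred k : ℝ) / (Real.sqrt ((pred k : ℝ) + k + 1) + Real.sqrt ((pred k : ℝ) + 1)) := ⟨_, rfl⟩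
    have hden : 0 < Real.sqrt ((pred k : ℝ) + k + 1) + Real.sqrt ((pred k : ℝ) + 1) := by positivity
    have hρ0 : 0 ≤ ρ := by rw [hρ_def]; positivity
    have hyoung : ρ * ∑ s ∈ A.filter (fun s => s ≤ pred k), x s * Real.sqrt ((s : ℝ) / pred k) ≤
        ∑ s ∈ A.filter (fun s => s ≤ pred k), x s * ((∑ l ∈ range k, Real.sqrt ((s : ℝ) / ((s : ℝ) + l + 1))) / k) := by
      rw [mul_sum]
      refine sum_le_sum fun s hs => ?_
      have hsA := (mem_filter.mp hs).1; have hsp : s ≤ pred k := (mem_filter.mp hs).2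
      have hs1 : (0 : ℝ) < s := by exact_mod_cast hA1 s hsA
      have hsp' : (s : ℝ) ≤ pred k := by exact_mod_cast hsp
      have htel := readWindow_ge_telescope hs1 k
      have hposs : 0 < Real.sqrt ((s : ℝ) + k + 1) + Real.sqrt ((s : ℝ) + 1) := by positivity
      have hdiff : Real.sqrt ((s : ℝ) + k + 1) - Real.sqrt ((s : ℝ) + 1) = k / (Real.sqrt ((s : ℝ) + k + 1) + Real.sqrt ((s : ℝ) + 1)) := by
        have e1 : Real.sqrt ((s : ℝ) + k + 1) * Real.sqrt ((s : ℝ) + k + 1) = (s : ℝ) + k + 1 := Real.mul_self_sqrt (by positivity)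
        have e2 : Real.sqrt ((s : ℝ) + 1) * Real.sqrt ((s : ℝ) + 1) = (s : ℝ) + 1 := Real.mul_self_sqrt (by positivity)
        have hab : (Real.sqrt ((s : ℝ) + k + 1) - Real.sqrt ((s : ℝ) + 1)) * (Real.sqrt ((s : ℝ) + k + 1) + Real.sqrt ((s : ℝ) + 1)) = k := by
          nlinarith [e1, e2]
        rw [eq_div_iff hposs.ne']; exact hab
      have hdens : Real.sqrt ((s : ℝ) + k + 1) + Real.sqrt ((s : ℝ) + 1) ≤ Real.sqrt ((pred k : ℝ) + k + 1) + Real.sqrt ((pred k : ℝ) + 1) :=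
        add_le_add (Real.sqrt_le_sqrt (by linarith)) (Real.sqrt_le_sqrt (by linarith))
      have hW : 2 * Real.sqrt (s : ℝ) / (Real.sqrt ((pred k : ℝ) + k + 1) + Real.sqrt ((pred k : ℝ) + 1)) ≤
          (∑ l ∈ range k, Real.sqrt ((s : ℝ) / ((s : ℝ) + l + 1))) / k := by
        rw [le_div_iff₀ hkr]
        calc 2 * Real.sqrt (s : ℝ) / (Real.sqrt ((pred k : ℝ) + k + 1) + Real.sqrt ((pred k : ℝ) + 1)) * k
            ≤ 2 * Real.sqrt (s : ℝ) / (Real.sqrt ((s : ℝ) + k + 1) + Real.sqrt ((s : ℝ) + 1)) * k := by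
              apply mul_le_mul_of_nonneg_right _ hkr.le
              exact div_le_div_of_nonneg_left (by positivity) hposs hdens
          _ = 2 * Real.sqrt (s : ℝ) * (Real.sqrt ((s : ℝ) + k + 1) - Real.sqrt ((s : ℝ) + 1)) := by rw [hdiff]; field_simp
          _ ≤ ∑ l ∈ range k, Real.sqrt ((s : ℝ) / ((s : ℝ) + l + 1)) := htel
      have hsq : Real.sqrt (s : ℝ) = Real.sqrt (pred k : ℝ) * Real.sqrt ((s : ℝ) / pred k) := by
        rw [← Real.sqrt_mul (by positivity)]; congr 1; field_simp
      calc ρ * (x s * Real.sqrt ((s : ℝ) / pred k)) = x s * (2 * Real.sqrt (s : ℝ) / (Real.sqrt ((pred k : ℝ) + k + 1) + Real.sqrt ((pred k : ℝ) + 1))) := by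
            rw [hρ_def, hsq]; ring
        _ ≤ x s * ((∑ l ∈ range k, Real.sqrt ((s : ℝ) / ((s : ℝ) + l + 1))) / k) := mul_le_mul_of_nonneg_left hW (hx s hsA)
    have hsqrtk : 0 < Real.sqrt (k : ℝ) := Real.sqrt_pos.mpr hkr
    have hA' : Real.sqrt ((pred k : ℝ) + k + 1) ≤ 71 / 60 * Real.sqrt (k : ℝ) := by
      rw [show (71 : ℝ) / 60 * Real.sqrt (k : ℝ) = Real.sqrt ((71 / 60) ^ 2 * k) by
        rw [Real.sqrt_mul (by norm_num), Real.sqrt_sq (by norm_num)]]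
      exact Real.sqrt_le_sqrt (by nlinarith)
    have hB' : Real.sqrt ((pred k : ℝ) + 1) ≤ 19 / 30 * Real.sqrt (k : ℝ) := by
      rw [show (19 : ℝ) / 30 * Real.sqrt (k : ℝ) = Real.sqrt ((19 / 30) ^ 2 * k) by
        rw [Real.sqrt_mul (by norm_num), Real.sqrt_sq (by norm_num)]]
      exact Real.sqrt_le_sqrt (by nlinarith)
    have hconv : Real.sqrt ((pred k : ℝ) / k) = (Real.sqrt ((pred k : ℝ) + k + 1) + Real.sqrt ((pred k : ℝ) + 1)) / (2 * Real.sqrt (k : ℝ)) * ρ := by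
      rw [hρ_def, Real.sqrt_div (by positivity)]
      field_simp
    have hfac : (Real.sqrt ((pred k : ℝ) + k + 1) + Real.sqrt ((pred k : ℝ) + 1)) / (2 * Real.sqrt (k : ℝ)) ≤ 109 / 120 := by
      rw [div_le_iff₀ (by positivity)]; linarith
    have hρZ0 : 0 ≤ ρ * ∑ s ∈ A.filter (fun s => s ≤ pred k), x s * Real.sqrt ((s : ℝ) / pred k) := mul_nonneg hρ0 hZ0
    have hyg : Real.sqrt ((pred k : ℝ) / k) * (∑ s ∈ A.filter (fun s => s ≤ pred k), x s * Real.sqrt ((s : ℝ) / pred k)) * (120 / 109) ≤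
        ρ * ∑ s ∈ A.filter (fun s => s ≤ pred k), x s * Real.sqrt ((s : ℝ) / pred k) := by
      calc Real.sqrt ((pred k : ℝ) / k) * (∑ s ∈ A.filter (fun s => s ≤ pred k), x s * Real.sqrt ((s : ℝ) / pred k)) * (120 / 109)
          = (Real.sqrt ((pred k : ℝ) + k + 1) + Real.sqrt ((pred k : ℝ) + 1)) / (2 * Real.sqrt (k : ℝ)) *
              (ρ * ∑ s ∈ A.filter (fun s => s ≤ pred k), x s * Real.sqrt ((s : ℝ) / pred k)) * (120 / 109) := by
            rw [hconv]; ring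
        _ ≤ 109 / 120 * (ρ * ∑ s ∈ A.filter (fun s => s ≤ pred k), x s * Real.sqrt ((s : ℝ) / pred k)) * (120 / 109) :=
            mul_le_mul_of_nonneg_right (mul_le_mul_of_nonneg_right hfac hρZ0) (by norm_num)
        _ = ρ * ∑ s ∈ A.filter (fun s => s ≤ pred k), x s * Real.sqrt ((s : ℝ) / pred k) := by ring
    linarith
  · -- k = 4, pred k = 1 = m₀: exact sums
    have hk4 : k = 4 := by omega
    have hp1' : pred k = 1 := by omega
    have hm1 : m₀ = 1 := le_antisymm (hp1' ▸ hmin _ hpA) (hA1 m₀ hm₀)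
    have hfilter_m₀ : A.filter (fun s => s ≤ m₀) = {m₀} := by
      ext s; simp only [mem_filter, mem_singleton]
      constructor
      · rintro ⟨hs, hsm⟩; exact le_antisymm hsm (hmin s hs)
      · rintro rfl; exact ⟨hm₀, le_rfl⟩
    have hfilt : A.filter (fun s => s ≤ pred k) = {m₀} := by rw [hp1', ← hm1]; exact hfilter_m₀
    rw [hfilt, sum_singleton] at hd
    rw [hfilt, sum_singleton]
    have hm1r : (0 : ℝ) < m₀ := by exact_mod_cast hA1 m₀ hm₀
    have hZ1 : x m₀ * Real.sqrt ((m₀ : ℝ) / pred k) = x m₀ := by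
      rw [hp1', ← hm1, div_self hm1r.ne', Real.sqrt_one, mul_one]
    have hsq14 : Real.sqrt ((pred k : ℝ) / k) = 1 / 2 := by
      rw [hp1', hk4]; push_cast
      rw [show (1 : ℝ) / 4 = (1 / 2) ^ 2 by norm_num]; exact Real.sqrt_sq (by norm_num)
    rw [hZ1, hsq14]
    rw [hk4, hm1] at hd; push_cast at hd
    have hS44 := readWindow_four_four_ge
    have hS14 := readWindow_one_four_ge
    have hx4 : 0 ≤ x 4 := hk4 ▸ hxk
    have hx1 : 0 ≤ x 1 := hm1 ▸ hx m₀ hm₀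
    rw [hm1]
    have e1 : x 4 * (200 / 259) ≤ x 4 * ((∑ l ∈ range 4, Real.sqrt ((4 : ℝ) / ((4 : ℝ) + l + 1))) / 4) := by
      refine mul_le_mul_of_nonneg_left ?_ hx4
      rw [le_div_iff₀ (by norm_num : (0 : ℝ) < 4)]; linarith
    have e2 : 1 / 2 * x 1 * (120 / 109) ≤ x 1 * ((∑ l ∈ range 4, Real.sqrt ((1 : ℝ) / ((1 : ℝ) + l + 1))) / 4) := by
      rw [show 1 / 2 * x 1 * (120 / 109) = x 1 * (60 / 109 : ℝ) by ring]
      refine mul_le_mul_of_nonneg_left ?_ hx1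
      rw [le_div_iff₀ (by norm_num : (0 : ℝ) < 4)]; linarith
    have hk4x : x k = x 4 := by rw [hk4]
    rw [hk4x]
    linarith


/-- **THE CRUDE LINE AT ANY NON-MINIMAL AGE.**  `A` a finite set of ages `≥ 1` with minimum `m₀` and predecessor map `pred`; loads `x ≥ 0` obeying the window
budget of (E65a) at the scales `j = k ∈ A`.  Then at every `k ≠ m₀`, with `r = pred k∕k` (ANY ratio): **`x_k√(1∕2) + Z_{pred k}·√(r∕(1+r)) ≤ 1∕2`**,
`Z_q = Σ_{s∈A, s≤q} x_s√(s∕q)` — (E65h)'s crude form, then `√(s∕(s+k)) ≥ √(s∕pred k)·√(pred k∕(pred k + k))` for `s ≤ pred k`. [folklore] -/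
theorem crude_line_at {A : Finset ℕ} {x : ℕ → ℝ} {pred : ℕ → ℕ} {m₀ : ℕ}
    (hA1 : ∀ k ∈ A, 1 ≤ k) (hx : ∀ k ∈ A, 0 ≤ x k)
    (hpred : ∀ k ∈ A, k ≠ m₀ → pred k ∈ A ∧ pred k < k ∧ ∀ k'' ∈ A, k'' < k → k'' ≤ pred k)
    (hbud : ∀ k ∈ A, ∑ s ∈ A, x s * (if s ≤ k then (∑ l ∈ range k, Real.sqrt ((s : ℝ) / ((s : ℝ) + l + 1))) / k
        else (∑ l ∈ range k, Real.sqrt ((s : ℝ) / ((s : ℝ) + l + 1))) / s) ≤ 1 / 2)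
    {k : ℕ} (hk : k ∈ A) (hne : k ≠ m₀) :
    x k * Real.sqrt (1 / 2) + (∑ s ∈ A.filter (fun s => s ≤ pred k), x s * Real.sqrt ((s : ℝ) / pred k)) *
        Real.sqrt (((pred k : ℝ) / k) / (1 + (pred k : ℝ) / k)) ≤ 1 / 2 := by
  obtain ⟨hpA, hplt, hpmax⟩ := hpred k hk hne
  have hkr : (0 : ℝ) < k := by exact_mod_cast hA1 k hk
  have hpr : (0 : ℝ) < pred k := by exact_mod_cast hA1 _ hpA
  have hcr := budget_crude_of_window hA1 hx hk (hbud k hk)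
  have hdiag : Real.sqrt ((k : ℝ) / ((k : ℝ) + k)) = Real.sqrt (1 / 2) := by
    congr 1; field_simp; ring
  have hset : A.filter (fun s => s < k) = A.filter (fun s => s ≤ pred k) := by
    ext s; simp only [mem_filter]
    constructor
    · rintro ⟨hs, hsk⟩; exact ⟨hs, hpmax s hs hsk⟩
    · rintro ⟨hs, hsp⟩; exact ⟨hs, lt_of_le_of_lt hsp hplt⟩
  have hrr : ((pred k : ℝ) / k) / (1 + (pred k : ℝ) / k) = (pred k : ℝ) / ((pred k : ℝ) + k) := by
    field_simp; ring
  rw [hdiag, hset] at hcr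
  rw [hrr, sum_mul]
  have hterm : ∀ s ∈ A.filter (fun s => s ≤ pred k),
      x s * Real.sqrt ((s : ℝ) / pred k) * Real.sqrt ((pred k : ℝ) / ((pred k : ℝ) + k)) ≤ x s * Real.sqrt ((s : ℝ) / ((s : ℝ) + k)) := by
    intro s hs
    have hsA := (mem_filter.mp hs).1; have hsp : s ≤ pred k := (mem_filter.mp hs).2
    have hs0 : (0 : ℝ) ≤ s := Nat.cast_nonneg s
    have hsp' : (s : ℝ) ≤ pred k := by exact_mod_cast hsp
    rw [mul_assoc, ← Real.sqrt_mul (by positivity)]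
    refine mul_le_mul_of_nonneg_left (Real.sqrt_le_sqrt ?_) (hx s hsA)
    rw [show (s : ℝ) / pred k * ((pred k : ℝ) / ((pred k : ℝ) + k)) = (s : ℝ) / ((pred k : ℝ) + k) by field_simp,
      div_le_div_iff₀ (by positivity) (by positivity)]
    nlinarith
  linarith [sum_le_sum hterm]

end Summit.QuantumFields.BalabanUV.Beta.EriceRemainderEnclosureHistoryAutonomyComparisonTowerFreeEndsBudget

end
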